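import Mathlib
import Summits.Langlands.Langlands.Theses.TorsionKudlaMillsonWindow
import Literature.NumberTheory.Automorphic.QuaternionCoordOrder
import HarnessLib

/-!
# `TorsionKudlaMillsonWindow.FTraceCongruenceGenerationOfPieces` (stmt-Langlands-18924) — proved BY NAME

Leaf proof (decomp-langlands cell, lens-5 g36, LEAF-PROOF kit 2; route freeze honoured — typed, checked and
dry-run by the lens seat, landed by the census pen).

The item is the GLUE of the strategist's BC2-redirect decomposition of the crux
`FTraceCongruenceGeneration` (stmt-Langlands-13533, binder `gen` of the certified `closes` of
`route-Langlands-TorsionKudlaMillsonWindow`):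

  `CosetFTraceTwist → TorsionTraceFinite → CongruenceCosetCapture → FTraceCongruenceGeneration`.

Content (pure group theory inside the unit group of the coordinate order `O = 𝓞_K⟨1,i,j,k⟩` of the
definite/indefinite quaternion algebra `ℍ[K, a, b]` over the quadratic window `K/F`): the finite torsion-trace
set `T` of `TorsionTraceFinite` is fed to `CosetFTraceTwist`, which returns the exceptional square classes
`C`, the level `M` and the base point `x`; these are fed to `CongruenceCosetCapture`, which returns `M'`.
For a norm-one `γ ≡ 1 (mod M'·O)`: `γ = t₁⁻¹ t₂` with `t₁, t₂ ∈ Good`, and each `tᵢ = (tᵢ uᵢ) uᵢ⁻¹` with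
`uᵢ`, `tᵢ uᵢ` norm-one units of `O` whose reduced traces lie in `F` and whose real parts avoid `T` — hence
F-trace elements of infinite order — so `γ = u₁ (t₁u₁)⁻¹ (t₂u₂) u₂⁻¹` lies in the subgroup generated by the
F-trace loxodromics (and commutators).  Closure of `O¹` under products is read off
`Literature.NumberTheory.Automorphic.QuaternionAlgebra.normOneGroup`, whose membership predicate is the
route's inline `IsG u ∧ u ū = 1` by `Iff.rfl`.

PROVENANCE.  The proof term is the kernel-checked composition `FTraceCongruenceGeneration_of` of the
registered line `Summits/Langlands/Langlands/Cruxes/FTraceCongruenceGeneration/Lines/coset_twist.lean`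
(planner-cstrat-stmt-Langlands-13533-r1-0, 2026-08-17; identical to the candidate `Assembly.lean` attached as
evidence on stmt-Langlands-18924, never landed under `Theorems/`), ported verbatim (one `show` added) so that it
concludes the route item BY NAME.  No Literature named fact is consumed; no `sorry`; standard axioms.
[folklore]
-/

set_option linter.dupNamespace false

namespace Summit.Langlands.Langlands.Theorems.TorsionKudlaMillsonWindowFTraceCongruenceGenerationOfPieces

open Summit.Langlands.Langlands.Theses.TorsionKudlaMillsonWindow
open scoped Quaternion
open NumberField Literature.NumberTheory.Automorphic

/-- **stmt-Langlands-18924** `TorsionKudlaMillsonWindow.FTraceCongruenceGenerationOfPieces` holds: the three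
pieces imply the crux `FTraceCongruenceGeneration` (all four decls are the route's, BY NAME; the item's `def`
unfolds to the implication, exposed by `show`) — `γ = u₁ (t₁u₁)⁻¹ (t₂u₂) u₂⁻¹` with all four factors F-trace
elements of infinite order.  Stated ONLY at the item's type, so that no declared constant of this file has a
type ending in another route item. [folklore] -/
theorem fTraceCongruenceGenerationOfPieces_proof :
    Summit.Langlands.Langlands.Theses.TorsionKudlaMillsonWindow.FTraceCongruenceGenerationOfPieces := by
  show CosetFTraceTwist → TorsionTraceFinite → CongruenceCosetCapture → FTraceCongruenceGeneration
  intro hX1 hX2 hX3 F K _ _ _ _ _ σ a b hF hK2 hσ hcx ha hb hneg hpos a' b' hdiv IsInt IsG Cong FTr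
  -- the three pieces, specialised to the present data
  obtain ⟨T, hT⟩ := hX2 F K σ a b hF hK2 hσ hcx ha hb hneg hpos hdiv
  obtain ⟨C, M, x, hM, hx, hdec⟩ := hX1 F K σ a b hF hK2 hσ hcx ha hb hneg hpos hdiv T
  obtain ⟨M', hM', hcap⟩ := hX3 F K σ a b hF hK2 hσ hcx ha hb hneg hpos hdiv M x C hM hx
  refine ⟨M', hM', fun γ hγ hγ1 => ?_⟩
  obtain ⟨t₁, t₂, ht₁, ht₂, rfl⟩ := hcap γ hγ hγ1
  -- the coordinate order `O = 𝓞_K⟨1,i,j,k⟩` of the tree: `IsG u ↔ u ∈ O^×` definitionally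
  set A : 𝓞 K := algebraMap (𝓞 F) (𝓞 K) a with hA
  set Bb : 𝓞 K := algebraMap (𝓞 F) (𝓞 K) b with hBb
  have hG1 : ∀ u : (ℍ[K, a', b'])ˣ, (IsG u ∧ (u : ℍ[K, a', b']) * star (u : ℍ[K, a', b']) = 1) ↔
      u ∈ QuaternionAlgebra.normOneGroup (R := 𝓞 K) K A Bb := fun u => Iff.rfl
  -- closure bookkeeping
  set S : Set (ℍ[K, a', b'])ˣ := {u | FTr u} ∪ {w | ∃ u v, IsG u ∧ IsG v ∧ w = u * v * u⁻¹ * v⁻¹}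
    with hS
  have memS : ∀ u : (ℍ[K, a', b'])ˣ, IsG u → (u : ℍ[K, a', b']) * star (u : ℍ[K, a', b']) = 1 →
      σ (u : ℍ[K, a', b']).re = (u : ℍ[K, a', b']).re → (u : ℍ[K, a', b']).re ∉ T →
      u ∈ Subgroup.closure S := by
    intro u hu hu1 hre hT'
    refine Subgroup.subset_closure (Set.mem_union_left _ ?_)
    exact ⟨hu, hu1, hre, fun hfin => hT' (hT u hu hu1 hfin)⟩
  -- twist one factor: `t = (t u) u⁻¹` with both `u` and `t u` F-trace loxodromics
  have twist : ∀ t u : (ℍ[K, a', b'])ˣ,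
      (IsG t ∧ (t : ℍ[K, a', b']) * star (t : ℍ[K, a', b']) = 1) →
      (IsG u ∧ (u : ℍ[K, a', b']) * star (u : ℍ[K, a', b']) = 1) →
      (∀ i : Fin 4, σ (QuaternionAlgebra.equivTuple a' 0 b' (u : ℍ[K, a', b']) i) =
        QuaternionAlgebra.equivTuple a' 0 b' (u : ℍ[K, a', b']) i) →
      σ ((t * u : (ℍ[K, a', b'])ˣ) : ℍ[K, a', b']).re = ((t * u : (ℍ[K, a', b'])ˣ) : ℍ[K, a', b']).re →
      (u : ℍ[K, a', b']).re ∉ T → ((t * u : (ℍ[K, a', b'])ˣ) : ℍ[K, a', b']).re ∉ T →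
      t ∈ Subgroup.closure S := by
    intro t u ht1 hu hcoord htr huT htuT
    have htu : IsG (t * u) ∧ ((t * u : (ℍ[K, a', b'])ˣ) : ℍ[K, a', b']) *
        star ((t * u : (ℍ[K, a', b'])ˣ) : ℍ[K, a', b']) = 1 :=
      (hG1 (t * u)).mpr (Subgroup.mul_mem _ ((hG1 t).mp ht1) ((hG1 u).mp hu))
    have hure : σ (u : ℍ[K, a', b']).re = (u : ℍ[K, a', b']).re := by
      simpa [QuaternionAlgebra.equivTuple_apply] using hcoord 0
    have hu_mem : u ∈ Subgroup.closure S := memS u hu.1 hu.2 hure huT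
    have htu_mem : t * u ∈ Subgroup.closure S := memS (t * u) htu.1 htu.2 htr htuT
    have : t = (t * u) * u⁻¹ := by group
    rw [this]
    exact Subgroup.mul_mem _ htu_mem (Subgroup.inv_mem _ hu_mem)
  obtain ⟨u₁, hu₁, hco₁, htr₁, hu₁T, htu₁T⟩ := hdec t₁ ht₁
  obtain ⟨u₂, hu₂, hco₂, htr₂, hu₂T, htu₂T⟩ := hdec t₂ ht₂
  obtain ⟨ht₁1, -, -⟩ := ht₁
  obtain ⟨ht₂1, -, -⟩ := ht₂
  exact Subgroup.mul_mem _ (Subgroup.inv_mem _ (twist t₁ u₁ ht₁1 hu₁ hco₁ htr₁ hu₁T htu₁T))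
    (twist t₂ u₂ ht₂1 hu₂ hco₂ htr₂ hu₂T htu₂T)

end Summit.Langlands.Langlands.Theorems.TorsionKudlaMillsonWindowFTraceCongruenceGenerationOfPieces
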